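import Mathlib
import Summits.Ventures.PercRepro2.HubKernelP1Cert

/-!
# The kernel check of the hub certificates for p1's kernel `K₃`, first index `4`, second index `0` — the five kernel steps
(blind cell PercRepro2, typer-1 g13; the RULING (F) / OPS (ii) re-emission of `HubKernelP1Chunk4.lean`'s
`hub_checkK3_4` in smaller kernel steps: the twenty-five atom triples `(4, b, d)` one `decide +kernel` each,
five files of five, so that the whole module re-elaborates under the farm's memory cap; `HubKernelP1Chunk4.lean`
assembles them into the unchanged statement `hub_checkK3_4 : ∀ b d : Fin 5, 2 * kronSymK3 4 b d = certNum 4 b d`)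
-/

namespace Summit.Ventures.PercRepro2.Hub

set_option maxHeartbeats 0 in
set_option maxRecDepth 100000 in
/-- The instance `b = 0`, `d = 0` of `hub_checkK3_4` (one kernel step). -/
theorem hub_checkK3_4_0_0 : 2 * kronSymK3 4 0 0 = certNum 4 0 0 := by
  decide +kernel

set_option maxHeartbeats 0 in
set_option maxRecDepth 100000 in
/-- The instance `b = 0`, `d = 1` of `hub_checkK3_4` (one kernel step). -/
theorem hub_checkK3_4_0_1 : 2 * kronSymK3 4 0 1 = certNum 4 0 1 := by
  decide +kernel

set_option maxHeartbeats 0 in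
set_option maxRecDepth 100000 in
/-- The instance `b = 0`, `d = 2` of `hub_checkK3_4` (one kernel step). -/
theorem hub_checkK3_4_0_2 : 2 * kronSymK3 4 0 2 = certNum 4 0 2 := by
  decide +kernel

set_option maxHeartbeats 0 in
set_option maxRecDepth 100000 in
/-- The instance `b = 0`, `d = 3` of `hub_checkK3_4` (one kernel step). -/
theorem hub_checkK3_4_0_3 : 2 * kronSymK3 4 0 3 = certNum 4 0 3 := by
  decide +kernel

set_option maxHeartbeats 0 in
set_option maxRecDepth 100000 in
/-- The instance `b = 0`, `d = 4` of `hub_checkK3_4` (one kernel step). -/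
theorem hub_checkK3_4_0_4 : 2 * kronSymK3 4 0 4 = certNum 4 0 4 := by
  decide +kernel

end Summit.Ventures.PercRepro2.Hub
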